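import Summits.BirchSwinnertonDyer.BirchSwinnertonDyer.Theorems.PrintCFramBottomClassIndexLawFiveLeBorelTopLayerClasses
import HarnessLib

/-!
# Route `PrintCFram`, crux C2 `BottomClassIndexLawFiveLe` (stmt-BirchSwinnertonDyer-20372), line
# `eisenstein-resource-bdp-line`, stub `stub_kolyvaginUpper_borelCM_pairSum_offKrizLi`:
# **TOP-LAYER INDEPENDENCE IS AUTOMATIC ACROSS (SIGN, DEPTH-PARITY) CLASSES, II — FILE 7's `hind` FROM
# `hind` ON CLASSES; INJECTIVE LABELS; OPPOSITE-SIGN PAIRS NEED NOTHING**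
# (cell `bsd-print-cfram`, seat `bsd-line-cfram-p1-w2` g7; helper `--supports` 20372; 0 facts, 0 defs, 0 sorry)

HONEST FRAMING. Nothing about BSD is proved here, and nothing of the stub itself. Sequel of
`…BorelTopLayerClasses` (`sum_top_class_eq_zero`: every linear relation among the top functionals
`T_i(ρ) = μ^{e_i−1}[x_i, ρ]^♭` of a family of `c_*`-eigenclasses restricts to each class of the label
(`(−1)^{e_i−1}`, `ν_i`), because an `𝓞`-antilinear `g ∈ Γ_K` twists a relation by the parity label and
complex conjugation by the sign label).

* **`hind_of_hind_on_classes`** — FILE 7's `hind` (`p ∣ a_i` for every relation `∑ a_i T_i = 0` and every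
  `i` with `e_i > 0`) follows from the same statement for coefficient vectors supported on ONE class.
* **`hind_of_injective_label`** — if no two members with `e_i > 0` share a label and every such member has
  a non-zero top (exact depth), `hind` holds with no further hypothesis.
* **`hind_pair_of_opposite_sign`** — in particular for ANY two eigenclasses of opposite signs with exact
  positive depths: the pair `{y, s}` of Claim A (shape (B2) of `…BorelDescentClaimA`) and `{s, c(ℓ)}` of
  Claim B need NO independence hypothesis; FILE 6/7 apply to them verbatim. (Shape (B3) `{x, s, c(ℓ)}`
  needs only `x`/`s` decorrelated — same sign and parity — which the split (B4) arranges; not here.)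

An `𝓞`-antilinear `g ∈ Γ_K` exists whenever `−p` is not a square in `K` (tree `exists_restrict_smul_eq_neg`).
THEOREMS ONLY; no definition, no named fact, no `sorry`. BSD is not proved by any of this; no summit
statement is proved by this seat. References: [McCallumLMS1991] §3 (Prop. 3.1, Cor. 3.2); [GrossLMS1991] §9.
-/

set_option autoImplicit false
-- `…BirchSwinnertonDyer.BirchSwinnertonDyer.Theorems…` is the problem's mandated namespace (D-0017).
set_option linter.dupNamespace false

noncomputable section

open scoped Classical

namespace Summit.BirchSwinnertonDyer.BirchSwinnertonDyer.Theorems.PrintCFram.BorelKolyvaginPairing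

open WeierstrassCurve NumberField IsDedekindDomain Field Literature.NumberTheory.EllipticCurves
  Literature.NumberTheory.GaloisRepresentations Literature.NumberTheory.EllipticCurves.Rank1Residual
  Summit.BirchSwinnertonDyer.BirchSwinnertonDyer.Theorems.PrintCFram.BorelHomothety

/-! ## §3 FILE 7's `hind` from independence on each class; injective labels; opposite-sign pairs -/

section Hind

variable (W : WeierstrassCurve ℚ) [W.IsElliptic] (p : ℕ) [hp : Fact p.Prime]
variable {K : Type} [Field K] [NumberField K] {ι : Type*} [Fintype ι]

omit [W.IsElliptic] in
/-- **`hind` of the Borel `cebotarev` axiom from `hind` on each (parity, sign) class.** In the setting of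
FILE 7 (`𝓞_𝔭`-structure `(s, μ, m)`, `K` a number field in which `−p` is not a square, complex conjugation
`c₀` lifted to `c`, line sign `η`, `c_*`-eigenclasses `x_i` of signs `ν_i` with values killed by `μ^{e_i}`):
if for every `(α, β) ∈ {±1}²` every relation among the top functionals with coefficients supported on
`{i : (−1)^{e_i−1} = α, ν_i = β}` has `p ∣ b_i` whenever `e_i > 0`, then the same holds for ALL relations
(FILE 7's hypothesis `hind`). [cite: McCallumLMS1991, §3 Cor. 3.2] -/
theorem hind_of_hind_on_classes {s : AlgebraicClosure ℚ} {μ : AddMonoid.End W.geomPoints} {m : ℤ}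
    (hs : s ^ 2 = ((-(p : ℤ) : ℤ) : AlgebraicClosure ℚ)) (hm : m.natAbs = p)
    (hμμ : ∀ P, μ (μ P) = m • P)
    (hanti : ∀ g : absoluteGaloisGroup ℚ, g • s = -s → ∀ P, μ (g • P) = -(g • μ P))
    (hp2 : p ≠ 2) (hKp : ∀ y : K, y ^ 2 ≠ -(p : K))
    {c : K ≃ₐ[ℚ] K} {c₀ : absoluteGaloisGroup ℚ} (hc₀ : IsComplexConjugation (Rat.castHom ℝ) c₀)
    (ht : IsLiftOfAut c (absGaloisTransport (K := ℚ) (L := K) c₀).toRingEquiv)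
    {η : ℤ} (hηs : η = 1 ∨ η = -1) (hη : ∀ P : W.geomPoints, μ P = 0 → c₀ • P = η • P)
    (n : ℤ) (xs : ι → galH1Torsion (W.baseChange K) n) {ν : ι → ℤ} (hν : ∀ i, ν i = 1 ∨ ν i = -1)
    (hxs : ∀ i, conjAct W c n (xs i) = ν i • xs i) (e : ι → ℕ)
    (he : ∀ i, ∀ ρ ∈ torsionFixing (W.baseChange K) n,
      (μ ^ e i) ((RatClosure.torsionEquiv (K := K) W n).symm
        (h1Eval (W.baseChange K) n (xs i) ρ) : W.geomPoints) = 0)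
    (hcls : ∀ α β : ℤ, (α = 1 ∨ α = -1) → (β = 1 ∨ β = -1) → ∀ b : ι → ℤ,
      (∀ i, ¬ ((-1 : ℤ) ^ (e i - 1) = α ∧ ν i = β) → b i = 0) →
      (∀ ρ ∈ torsionFixing (W.baseChange K) n,
        ∑ i, b i • (μ ^ (e i - 1)) ((RatClosure.torsionEquiv (K := K) W n).symm
          (h1Eval (W.baseChange K) n (xs i) ρ) : W.geomPoints) = 0) →
        ∀ i, 0 < e i → (p : ℤ) ∣ b i)
    (a : ι → ℤ)
    (ha : ∀ ρ ∈ torsionFixing (W.baseChange K) n,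
      ∑ i, a i • (μ ^ (e i - 1)) ((RatClosure.torsionEquiv (K := K) W n).symm
        (h1Eval (W.baseChange K) n (xs i) ρ) : W.geomPoints) = 0)
    (i : ι) (hi : 0 < e i) : (p : ℤ) ∣ a i := by
  obtain ⟨g, hg⟩ := exists_restrict_smul_eq_neg p K hKp hs
  set α : ℤ := (-1) ^ (e i - 1) with hαdef
  set β : ℤ := ν i with hβdef
  have hα : α = 1 ∨ α = -1 := neg_one_pow_eq_or ℤ _
  set b : ι → ℤ := fun j ↦ if (-1 : ℤ) ^ (e j - 1) = α ∧ ν j = β then a j else 0 with hb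
  have hbsupp : ∀ j, ¬ ((-1 : ℤ) ^ (e j - 1) = α ∧ ν j = β) → b j = 0 := fun j hj ↦ by
    simp only [hb, if_neg hj]
  have hbrel : ∀ ρ ∈ torsionFixing (W.baseChange K) n,
      ∑ j, b j • (μ ^ (e j - 1)) ((RatClosure.torsionEquiv (K := K) W n).symm
        (h1Eval (W.baseChange K) n (xs j) ρ) : W.geomPoints) = 0 := fun ρ hρ ↦
    sum_top_class_eq_zero W p hs hm hμμ hanti hp2 hg hc₀ ht hηs hη n xs hν hxs e he ha hα (hν i) hρ
  have hdvd := hcls α β hα (hν i) b hbsupp hbrel i hi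
  have hbi : b i = a i := by simp [hb, hαdef, hβdef]
  rwa [hbi] at hdvd

omit [W.IsElliptic] in
/-- **Distinct labels need nothing.** If no two members with `e_i > 0` share the label
`((−1)^{e_i−1}, ν_i)` and every member with `e_i > 0` has a non-zero top functional (exact depth), then FILE
7's `hind` holds with no further hypothesis. [cite: McCallumLMS1991, §3 Cor. 3.2] -/
theorem hind_of_injective_label {s : AlgebraicClosure ℚ} {μ : AddMonoid.End W.geomPoints} {m : ℤ}
    (hs : s ^ 2 = ((-(p : ℤ) : ℤ) : AlgebraicClosure ℚ)) (hm : m.natAbs = p)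
    (hμμ : ∀ P, μ (μ P) = m • P)
    (hanti : ∀ g : absoluteGaloisGroup ℚ, g • s = -s → ∀ P, μ (g • P) = -(g • μ P))
    (hp2 : p ≠ 2) (hKp : ∀ y : K, y ^ 2 ≠ -(p : K))
    {c : K ≃ₐ[ℚ] K} {c₀ : absoluteGaloisGroup ℚ} (hc₀ : IsComplexConjugation (Rat.castHom ℝ) c₀)
    (ht : IsLiftOfAut c (absGaloisTransport (K := ℚ) (L := K) c₀).toRingEquiv)
    {η : ℤ} (hηs : η = 1 ∨ η = -1) (hη : ∀ P : W.geomPoints, μ P = 0 → c₀ • P = η • P)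
    (n : ℤ) (xs : ι → galH1Torsion (W.baseChange K) n) {ν : ι → ℤ} (hν : ∀ i, ν i = 1 ∨ ν i = -1)
    (hxs : ∀ i, conjAct W c n (xs i) = ν i • xs i) (e : ι → ℕ)
    (he : ∀ i, ∀ ρ ∈ torsionFixing (W.baseChange K) n,
      (μ ^ e i) ((RatClosure.torsionEquiv (K := K) W n).symm
        (h1Eval (W.baseChange K) n (xs i) ρ) : W.geomPoints) = 0)
    (htop : ∀ i, 0 < e i → ∃ ρ ∈ torsionFixing (W.baseChange K) n,
      (μ ^ (e i - 1)) ((RatClosure.torsionEquiv (K := K) W n).symm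
        (h1Eval (W.baseChange K) n (xs i) ρ) : W.geomPoints) ≠ 0)
    (hlab : ∀ i j, 0 < e i → 0 < e j → (-1 : ℤ) ^ (e i - 1) = (-1) ^ (e j - 1) → ν i = ν j → i = j)
    (a : ι → ℤ)
    (ha : ∀ ρ ∈ torsionFixing (W.baseChange K) n,
      ∑ i, a i • (μ ^ (e i - 1)) ((RatClosure.torsionEquiv (K := K) W n).symm
        (h1Eval (W.baseChange K) n (xs i) ρ) : W.geomPoints) = 0)
    (i : ι) (hi : 0 < e i) : (p : ℤ) ∣ a i := by
  refine hind_of_hind_on_classes W p hs hm hμμ hanti hp2 hKp hc₀ ht hηs hη n xs hν hxs e he ?_ a ha i hi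
  intro α β hα hβ b hbsupp hbrel j hj
  by_cases hclj : (-1 : ℤ) ^ (e j - 1) = α ∧ ν j = β
  swap
  · rw [hbsupp j hclj]; exact dvd_zero _
  -- in the class of `j`, the only member with a positive depth is `j`; the others have top `0`
  obtain ⟨ρ, hρ, hρtop⟩ := htop j hj
  have hsum := hbrel ρ hρ
  rw [Finset.sum_eq_single j (fun k _ hk ↦ ?_) (fun h ↦ absurd (Finset.mem_univ j) h)] at hsum
  · exact prime_dvd_of_zsmul_eq_zero p hp.out hρtop
      (prime_zsmul_eq_zero_of_apply_eq_zero W p hm hμμ (apply_top_eq_zero W (he j ρ hρ))) hsum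
  · by_cases hcl : (-1 : ℤ) ^ (e k - 1) = α ∧ ν k = β
    · by_cases hek : 0 < e k
      · exact absurd (hlab k j hek hj (hcl.1.trans hclj.1.symm) (hcl.2.trans hclj.2.symm)) hk
      · have he0 : e k = 0 := by omega
        have hval : ((RatClosure.torsionEquiv (K := K) W n).symm
            (h1Eval (W.baseChange K) n (xs k) ρ) : W.geomPoints) = 0 := by
          have := he k ρ hρ
          rwa [he0, pow_zero] at this
        rw [he0, Nat.zero_sub, pow_zero]
        change b k • ((RatClosure.torsionEquiv (K := K) W n).symm
          (h1Eval (W.baseChange K) n (xs k) ρ) : W.geomPoints) = 0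
        rw [hval, smul_zero]
    · rw [hbsupp k hcl, zero_smul]

omit [W.IsElliptic] in
/-- **Opposite signs need nothing.** For two `c_*`-eigenclasses `y` (sign `ε`) and `z` (sign `−ε`) with
exact positive depths (non-zero tops), FILE 7's `hind` holds for the family `![y, z]` — the shape (B2) of
`…BorelDescentClaimA` (Claim A's `{y, s}`) and the pair `{s, c(ℓ)}` of Claim B: an `𝓞`-antilinear element
separates depth parities and complex conjugation separates signs, so the two tops are never proportional.
[cite: McCallumLMS1991, §3 Cor. 3.2] -/
theorem hind_pair_of_opposite_sign {s : AlgebraicClosure ℚ} {μ : AddMonoid.End W.geomPoints} {m : ℤ}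
    (hs : s ^ 2 = ((-(p : ℤ) : ℤ) : AlgebraicClosure ℚ)) (hm : m.natAbs = p)
    (hμμ : ∀ P, μ (μ P) = m • P)
    (hanti : ∀ g : absoluteGaloisGroup ℚ, g • s = -s → ∀ P, μ (g • P) = -(g • μ P))
    (hp2 : p ≠ 2) (hKp : ∀ y : K, y ^ 2 ≠ -(p : K))
    {c : K ≃ₐ[ℚ] K} {c₀ : absoluteGaloisGroup ℚ} (hc₀ : IsComplexConjugation (Rat.castHom ℝ) c₀)
    (ht : IsLiftOfAut c (absGaloisTransport (K := ℚ) (L := K) c₀).toRingEquiv)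
    {η : ℤ} (hηs : η = 1 ∨ η = -1) (hη : ∀ P : W.geomPoints, μ P = 0 → c₀ • P = η • P)
    (n : ℤ) {y z : galH1Torsion (W.baseChange K) n} {ε : ℤ} (hε : ε = 1 ∨ ε = -1)
    (hy : conjAct W c n y = ε • y) (hz : conjAct W c n z = (-ε) • z) {ey ez : ℕ}
    (hey : 0 < ey) (hez : 0 < ez)
    (hye : ∀ ρ ∈ torsionFixing (W.baseChange K) n,
      (μ ^ ey) ((RatClosure.torsionEquiv (K := K) W n).symm (h1Eval (W.baseChange K) n y ρ) :
        W.geomPoints) = 0)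
    (hze : ∀ ρ ∈ torsionFixing (W.baseChange K) n,
      (μ ^ ez) ((RatClosure.torsionEquiv (K := K) W n).symm (h1Eval (W.baseChange K) n z ρ) :
        W.geomPoints) = 0)
    (hytop : ∃ ρ ∈ torsionFixing (W.baseChange K) n,
      (μ ^ (ey - 1)) ((RatClosure.torsionEquiv (K := K) W n).symm (h1Eval (W.baseChange K) n y ρ) :
        W.geomPoints) ≠ 0)
    (hztop : ∃ ρ ∈ torsionFixing (W.baseChange K) n,
      (μ ^ (ez - 1)) ((RatClosure.torsionEquiv (K := K) W n).symm (h1Eval (W.baseChange K) n z ρ) :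
        W.geomPoints) ≠ 0)
    (a : Fin 2 → ℤ)
    (ha : ∀ ρ ∈ torsionFixing (W.baseChange K) n,
      ∑ i, a i • (μ ^ (![ey, ez] i - 1)) ((RatClosure.torsionEquiv (K := K) W n).symm
        (h1Eval (W.baseChange K) n (![y, z] i) ρ) : W.geomPoints) = 0)
    (i : Fin 2) : (p : ℤ) ∣ a i := by
  have hεne : ε ≠ -ε := by rcases hε with rfl | rfl <;> decide
  refine hind_of_injective_label W p hs hm hμμ hanti hp2 hKp hc₀ ht hηs hη n ![y, z] (ν := ![ε, -ε])
    (fun j ↦ by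
      fin_cases j
      · exact hε
      · rcases hε with h | h <;> simp [h])
    (fun j ↦ by
      fin_cases j
      · exact hy
      · exact hz)
    ![ey, ez]
    (fun j ↦ by
      fin_cases j
      · exact hye
      · exact hze)
    (fun j hj ↦ by
      fin_cases j
      · exact hytop
      · exact hztop) ?_ a ha i
    (by
      fin_cases i
      · exact hey
      · exact hez)
  intro j k _ _ _ hνjk
  fin_cases j <;> fin_cases k <;> simp_all

end Hind

end Summit.BirchSwinnertonDyer.BirchSwinnertonDyer.Theorems.PrintCFram.BorelKolyvaginPairing

end
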